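import Summits.QuantumFields.BalabanUV.T4Continuum.Support.NE7SliceRepLetters
import Summits.QuantumFields.BalabanUV.T4Continuum.Support.NE7MinActHessianHessForm
import Summits.QuantumFields.BalabanUV.T4Continuum.Support.NE7BorderedHessianGaugeDegenerate
import Summits.QuantumFields.BalabanUV.T4Continuum.Support.AveragingDeficitMultiLevelBridge
import HarnessLib

/-!
# NE7BorderedHessianOnSlice — THE BORDERED HESSIAN OF THE CONSTRAINED MINIMAL ACTION IS ATTAINED ON THE MULTI-LEVEL SLICE, WHERE THE HESSIAN TERM OBEYS THE FLOOR: at every small datum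
# `V₀`, every minimiser `U♯`, every level `j`, every coarse direction `v`, there is a slice representative `X⋆` (`levelQ′ X⋆ = v`, `X̃⋆ − R₀ṽ ∈ T_♮(U♯)`) with
# **`D²(minAct∘chart_{V₀})(0)[v,v] = w·hess U♯ X̃⋆ X̃⋆ − Dm(0)[D²𝒢(0)[X⋆,X⋆]]`**, the HESSIAN FLOOR `Σ_P nhs(curl_{V₀}ṽ) ≤ ((1+θ)+2K·4C_P n)·hess U♯ X̃⋆ X̃⋆ + 2Kρ‖ṽ‖²`, the absorbed scaled mass
# `q·dirSq X̃⋆ ≤ 2·(4C_P n)·hess + 2ρ‖ṽ‖²` and the fine curl energy letter (d = 4, every U(n), L ≥ 2; j-, N-uniform constants; `ρ = 2liftMassC + 4C_P liftCurlC`) — (G′) IS THEREBY REDUCED TO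
# ONE LETTER: the multiplier term `Dm(0)[D²𝒢(0)[X⋆,X⋆]]` on slice representatives with controlled scaled mass and energy (lineage `b2b-balaban-t4-ne7-p1`, gen 118, file G12)

Cell `pub-balaban`, rung (B)+1 sub-cell t4, CRUX PROVER NE7 #1 (OWNER of row NE7), generation 118.  Composition BY NAME, inside the all-data frame `∃ε₀ ∀ε ∀N ∀j ∃δ_V ∀V₀ ∀U♯` of gen 115's
✓ `NE7MinActHessianHessForm.minAct_hessian_hessForm_allData` (the bordered Hessian as a constrained minimum, attained) and ✓ `NE7MinActHessianLagrangianAllData.multiplier_eq_fderiv_minAct_allData`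
(the multiplier identity), of: this gen's G11 ✓ `NE7SliceRepLetters.exists_cornerGauge_sliceRep_letters` (the slice representative of the MINIMISING lift and its letters), row NE7b's
✓ `NE7BorderedHessianGaugeDegenerate.borderedForm_add_gaugeDir` (the bordered value is unchanged), ✓ `NE7SecondVariationHess.second_variation` (`D²𝒜 = hess`), ✓
`AveragingDeficitMultiLevelBridge.cavgIter_eq_avgIter` (`cavgIter (j+1) U♯ = V₀` for minimisers).  The k-free ε-lines (at `2ε` for the class with room) and row NE3's slice Poincaré SHAPE
at `U♯` are displayed hypotheses (✓ `classSlicePoincare_of_lines` discharges the latter on the class; at L = 2, SU(2), ε ≤ 10⁻⁵³ everything is numeric — G8).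
WHAT ([folklore]; 0 def, 0 sorry; `d = 4`, `n : Type`): `classRadius_eq` (dictionary `ε∕(L^k)² = ε·(L²)⁻¹^k`), **`bordered_hessian_attained_on_slice`**.
HONEST FRAMING (page 1): composition of landed kernel theorems about OUR minimisers (B11 (8) with `sfClass`); quantifiers `∀ j ∃ δ_V` as in gen 115; the multiplier term is NOT bounded — (G′) is
NOT proved; nothing of Bałaban's asserted; NOT NE7 as a spine node, NOT NE3; spine 0∕9; finite T⁴ rung (B)+1 — NOT infinite volume, NOT mass gap, NOT BetaPertH, NOT Clay.
-/

set_option autoImplicit false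

open scoped BigOperators Matrix Matrix.Norms.L2Operator Topology
open NormedSpace Finset Set Filter Metric

namespace Summit.QuantumFields.BalabanUV.T4Continuum.NE7BorderedHessianOnSlice

open Literature.MathematicalPhysics.QuantumFieldTheory.Balaban1983to89
open B7Prop1Explicit B7Prop2Explicit MatrixLog UnitaryModel
open T4AveragingDeficitWall (IsUnitaryCfg IsSkewDir SmallField Ad curl curlAt curlSq dirSq fineAction)
open T4AveragingDeficitWallBoundary (IsPeriodicCfg periodBox)
open AveragingDeficitTorusChart (TDir chart chartDir resDir)
open AveragingDeficitTwoLevelPrep (twoLevelSmall skewSub skewPR)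
open AveragingDeficitMultiLevelPrep (cavgIter tower levelQ levelQ' LevelSmall natCast_tower_succ)
open AveragingDeficitMultiLevelBridge (cavgIter_eq_avgIter)
open MatrixNorms (nhsNormSq)
open MinimalActionLevels (perWin stepWt)
open MinimalActionSandwich (IsMinimiser minAct)
open MinimalActionRate (sfClass)
open NE3HessForm (hess)
open NE7RadIterUniform (radD radD_nonneg levelSmall_of_class_radius)
open NE7StraightTowerCurlEnergy (eC mC)
open NE7FlatAverageCurlCommutation (isSkewDir_chartDir_id)
open BlockAveragePushDirGauge (gaugeDir)
open NE3QbarIterCovLiftPrep (cruxC)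
open NE3RightInverseSolveLetters (thetaLoc)
open NE3SlicePoincareShape (SlicePoincare)
open NE3FrameFreeSliceW (frameFreeBlockLandauW)
open NE3EnergyRateWSupOfSlicePoincare (tower_eq_mul_pow)
open NE7FrameFreeRightInverse (rightInvW0)
open NE7SliceRepHessianFloor (liftMassC liftCurlC sliceRep_args)
open NE7SliceRepLetters (exists_cornerGauge_sliceRep_letters)
open NE7MinActHessianHessForm (minAct_hessian_hessForm_allData)
open NE7MinActHessianLagrangianAllData (multiplier_eq_fderiv_minAct_allData)
open NE7BorderedHessianGaugeDegenerate (borderedForm_add_gaugeDir fderiv_levelQ_chart_subtype_apply)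
open NE7SecondVariationHess (second_variation)

noncomputable section

variable {n : Type} [Fintype n] [DecidableEq n]

omit [Fintype n] [DecidableEq n] in
/-- The class radius dictionary: `ε ∕ (L^k)² = ε·(L²)⁻¹^k`. [folklore] -/
theorem classRadius_eq (L : ℕ) (ε : ℝ) (k : ℕ) : ε / ((L : ℝ) ^ k) ^ 2 = ε * (((L : ℝ) ^ 2)⁻¹) ^ k := by
  rw [div_eq_mul_inv, pow_right_comm, inv_pow]

set_option maxHeartbeats 400000 in
/-- **THE BORDERED HESSIAN IS ATTAINED ON THE MULTI-LEVEL SLICE, WITH THE HESSIAN FLOOR** (`d = 4`, every `U(n)`, `L ≥ 2`).  `∃ ε₀ > 0 ∀ 0 < ε ≤ ε₀` obeying the k-free lines (`hεD`, `hεT` at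
`2ε`; `hεM`, `ε ≤ 1`, `cruxC·ε < 1`, `thetaLoc·ε ≤ 1∕2`, `43584·ε ≤ 1∕2`) `∀ N ≥ 1 ∀ j ∃ δ_V > 0 ∀ V₀` (unitary, `N`-periodic, `δ_V`-small) `∀ U♯` minimiser over `V₀` `∀ C_P ≥ 0` with row NE3's
`SlicePoincare L (j+1) U♯ T_♮(U♯) C_P` and `28·#pl·ε·(4C_P n) ≤ 1` `∀ θ > 0 ∀ v`: there is `X⋆ : skewSub (L·tower L N j)` with `levelQ′ X⋆ = v` and
(1) `D²(minAct∘chart_{V₀})(0)[v,v] = w·hess U♯ X̃⋆ X̃⋆ (perWin 4 (tower L N (j+1))) − Dm(0)[D²𝒢(0)[X⋆,X⋆]]` (`w = stepWt⁻ʲ⁻¹`),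
(2) `Σ_{P∈perWin N} nhs(curl V₀ ṽ P) ≤ ((1+θ) + 2K·(4C_P n))·hess U♯ X̃⋆ X̃⋆ (perWin) + 2K·ρ·dirSq ṽ (periodBox N)`,
(3) `(L⁻¹)^{2(j+1)}·dirSq X̃⋆ (periodBox (tower)) ≤ 2(4C_P n)·hess + 2ρ·dirSq ṽ (periodBox N)` (`ρ = 2liftMassC + 4C_P liftCurlC`, `K = (1+θ)·14·#pl·ε + (1+θ⁻¹)·36eC²ε²`).
[cite: Balaban1985Variational, Thm 1 p.279, (83) p.290; Balaban1985Averaging, (48) p.25; Balaban1985PropagatorsII, Thm 3.3 (3.46)] -/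
theorem bordered_hessian_attained_on_slice [Nonempty n] {L : ℕ} [NeZero L] (hL : 2 ≤ L) :
    ∃ ε₀ : ℝ, 0 < ε₀ ∧ ∀ ε : ℝ, 0 < ε → ε ≤ ε₀ →
      4 * (2 * ε) * radD 4 L * (((L : ℝ) ^ 2)⁻¹) ^ 2 ≤ 1 → twoLevelSmall 4 L * (2 * (2 * ε) * ((L : ℝ) ^ 2)⁻¹) ≤ 1 →
      8 * (L : ℝ) * mC 4 L (Fintype.card n) * ε * ((L : ℝ) ^ 2)⁻¹ ≤ 1 → ε ≤ 1 → cruxC 4 L * ε < 1 → thetaLoc 4 L * ε ≤ 1 / 2 → 43584 * ε ≤ 1 / 2 →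
      ∀ (N : ℕ) [NeZero N], 1 ≤ N → ∀ j : ℕ,
      ∃ δV : ℝ, 0 < δV ∧
        ∀ V₀ ∈ {V : Site 4 → Fin 4 → (Matrix n n ℂ)ˣ | IsUnitaryCfg V ∧ IsPeriodicCfg V (N : ℤ) ∧ SmallField V δV},
        ∀ Us : Site 4 → Fin 4 → (Matrix n n ℂ)ˣ, IsMinimiser 4 (sfClass 4 L N ε) L N (j + 1) V₀ Us →
        ∀ CP : ℝ, 0 ≤ CP → SlicePoincare L (j + 1) Us (frameFreeBlockLandauW (d := 4) (n := n) L N (j + 1) Us) CP (periodBox (N * L ^ (j + 1))) →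
        28 * (Fintype.card (T4AveragingDeficitWall.Plane 4) : ℝ) * ε * (4 * CP * Fintype.card n) ≤ 1 → ∀ θ : ℝ, 0 < θ →
        ∀ v : ↥(skewSub 4 n N), ∃ Xs : ↥(skewSub 4 n (L * tower L N j)),
          levelQ' L N j Us (Xs : TDir 4 n (L * tower L N j)) = v
          ∧ fderiv ℝ (fderiv ℝ (fun y : ↥(skewSub 4 n N) => minAct 4 (sfClass 4 L N ε) L N (j + 1) (chart (ContinuousLinearMap.id ℝ (Matrix n n ℂ)) N V₀ (y : TDir 4 n N)))) 0 v v
              = ((stepWt 4 L)⁻¹) ^ (j + 1) * hess Us (chartDir (ContinuousLinearMap.id ℝ (Matrix n n ℂ)) (L * tower L N j) (Xs : TDir 4 n (L * tower L N j)))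
                    (chartDir (ContinuousLinearMap.id ℝ (Matrix n n ℂ)) (L * tower L N j) (Xs : TDir 4 n (L * tower L N j))) (perWin 4 (tower L N (j + 1)))
                - fderiv ℝ (fun y : ↥(skewSub 4 n N) => minAct 4 (sfClass 4 L N ε) L N (j + 1) (chart (ContinuousLinearMap.id ℝ (Matrix n n ℂ)) N V₀ (y : TDir 4 n N))) 0
                    (fderiv ℝ (fderiv ℝ (fun Φ : ↥(skewSub 4 n (L * tower L N j)) =>
                      levelQ L N j Us (chart (ContinuousLinearMap.id ℝ (Matrix n n ℂ)) (L * tower L N j) Us (Φ : TDir 4 n (L * tower L N j))))) 0 Xs Xs)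
          ∧ ∑ P ∈ perWin 4 N, nhsNormSq (curl V₀ (chartDir (ContinuousLinearMap.id ℝ (Matrix n n ℂ)) N (v : TDir 4 n N)) P)
              ≤ ((1 + θ) + 2 * ((1 + θ) * (14 * (Fintype.card (T4AveragingDeficitWall.Plane 4) : ℝ) * ε) + (1 + θ⁻¹) * (36 * eC 4 L (Fintype.card n) ^ 2 * ε ^ 2))
                    * (4 * CP * Fintype.card n))
                  * hess Us (chartDir (ContinuousLinearMap.id ℝ (Matrix n n ℂ)) (L * tower L N j) (Xs : TDir 4 n (L * tower L N j)))
                      (chartDir (ContinuousLinearMap.id ℝ (Matrix n n ℂ)) (L * tower L N j) (Xs : TDir 4 n (L * tower L N j))) (perWin 4 (tower L N (j + 1)))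
                + 2 * ((1 + θ) * (14 * (Fintype.card (T4AveragingDeficitWall.Plane 4) : ℝ) * ε) + (1 + θ⁻¹) * (36 * eC 4 L (Fintype.card n) ^ 2 * ε ^ 2))
                    * ((2 * liftMassC 4 L + 4 * CP * liftCurlC 4 L) * dirSq (chartDir (ContinuousLinearMap.id ℝ (Matrix n n ℂ)) N (v : TDir 4 n N)) (periodBox N))
          ∧ ((L : ℝ)⁻¹) ^ (2 * (j + 1)) * dirSq (chartDir (ContinuousLinearMap.id ℝ (Matrix n n ℂ)) (L * tower L N j) (Xs : TDir 4 n (L * tower L N j))) (periodBox (tower L N (j + 1)))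
              ≤ 2 * (4 * CP * Fintype.card n)
                  * hess Us (chartDir (ContinuousLinearMap.id ℝ (Matrix n n ℂ)) (L * tower L N j) (Xs : TDir 4 n (L * tower L N j)))
                      (chartDir (ContinuousLinearMap.id ℝ (Matrix n n ℂ)) (L * tower L N j) (Xs : TDir 4 n (L * tower L N j))) (perWin 4 (tower L N (j + 1)))
                + 2 * ((2 * liftMassC 4 L + 4 * CP * liftCurlC 4 L) * dirSq (chartDir (ContinuousLinearMap.id ℝ (Matrix n n ℂ)) N (v : TDir 4 n N)) (periodBox N)) := by
  have hL1 : 1 ≤ L := by omega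
  obtain ⟨ε₁, hε₁, H1⟩ := minAct_hessian_hessForm_allData (n := n) hL
  obtain ⟨ε₂, hε₂, H2⟩ := multiplier_eq_fderiv_minAct_allData (n := n) hL
  refine ⟨min ε₁ ε₂, lt_min hε₁ hε₂, fun ε hε hεle hεD2 hεT2 hεM hε1 hcrux hθl2 hEl N _ hN j => ?_⟩
  obtain ⟨δ₁, hδ₁, hA⟩ := H1 ε hε (hεle.trans (min_le_left _ _)) N hN j
  obtain ⟨δ₂, hδ₂, hB⟩ := H2 ε hε (hεle.trans (min_le_right _ _)) N hN j
  refine ⟨min δ₁ δ₂, lt_min hδ₁ hδ₂, fun V₀ hV₀ Us hUs CP hCP hSP habs θ hθ v => ?_⟩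
  obtain ⟨hV₀u, hV₀P, hV₀δ⟩ := hV₀
  obtain ⟨-, hbord⟩ := hA V₀ ⟨hV₀u, hV₀P, MinimalActionRate.SmallField.mono hV₀δ (min_le_left _ _)⟩
  obtain ⟨-, hleast⟩ := hbord Us hUs
  obtain ⟨-, hmult⟩ := hB V₀ ⟨hV₀u, hV₀P, MinimalActionRate.SmallField.mono hV₀δ (min_le_right _ _)⟩ Us hUs
  -- class facts for the minimiser
  obtain ⟨hUu, hUP0, hUx0⟩ := hUs.mem.1
  have hUP : IsPeriodicCfg Us ((tower L N (j + 1) : ℕ) : ℤ) := by rw [tower_eq_mul_pow]; exact hUP0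
  have hUx : SmallField Us (ε * (((L : ℝ) ^ 2)⁻¹) ^ (j + 1)) := by rw [← classRadius_eq]; exact hUx0
  have hUsavg : cavgIter L (j + 1) Us = V₀ := by rw [cavgIter_eq_avgIter]; exact hUs.mem.2
  have hUP' : IsPeriodicCfg Us ((L * tower L N j : ℕ) : ℤ) := hUP
  have hUP'' : IsPeriodicCfg Us ((L : ℤ) * (tower L N j : ℕ)) := by rw [← natCast_tower_succ]; exact hUP
  -- the ε-lines at `ε` from those at `2ε`
  have hε0 : 0 ≤ ε := hε.le
  have hq0 : 0 ≤ (((L : ℝ) ^ 2)⁻¹) := by positivity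
  have hεD : 4 * ε * radD 4 L * (((L : ℝ) ^ 2)⁻¹) ^ 2 ≤ 1 := by
    have h1 : 4 * ε * radD 4 L * (((L : ℝ) ^ 2)⁻¹) ^ 2 ≤ 4 * (2 * ε) * radD 4 L * (((L : ℝ) ^ 2)⁻¹) ^ 2 := by
      have := radD_nonneg (d := 4) L
      have : 0 ≤ ε * radD 4 L * (((L : ℝ) ^ 2)⁻¹) ^ 2 := by positivity
      nlinarith
    exact h1.trans hεD2
  have hεT : twoLevelSmall 4 L * (2 * ε * ((L : ℝ) ^ 2)⁻¹) ≤ 1 := by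
    have ht : 0 ≤ twoLevelSmall 4 L := by unfold AveragingDeficitTwoLevelPrep.twoLevelSmall; positivity
    have h1 : twoLevelSmall 4 L * (2 * ε * ((L : ℝ) ^ 2)⁻¹) ≤ twoLevelSmall 4 L * (2 * (2 * ε) * ((L : ℝ) ^ 2)⁻¹) := by
      refine mul_le_mul_of_nonneg_left ?_ ht
      have : 0 ≤ ε * ((L : ℝ) ^ 2)⁻¹ := by positivity
      nlinarith
    exact h1.trans hεT2
  -- the minimising lift
  obtain ⟨⟨X₀, hQ₀, hm⟩, -⟩ := hleast v
  -- G11 on the minimising lift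
  obtain ⟨hx, hs, hcr, hE⟩ := sliceRep_args hL hε0 hεD hεT hcrux hEl j
  have hvs : IsSkewDir (chartDir (ContinuousLinearMap.id ℝ (Matrix n n ℂ)) N ((levelQ' L N j Us (X₀ : TDir 4 n (L * tower L N j)) : ↥(skewSub 4 n N)) : TDir 4 n N)) :=
    isSkewDir_chartDir_id (levelQ' L N j Us (X₀ : TDir 4 n (L * tower L N j))).2
  obtain ⟨mu, hmus, hmuP, hmu0, hq, -, hfloor, hmass, -⟩ :=
    exists_cornerGauge_sliceRep_letters hL hN hε0 hεD hεT hεM hε1 hθl2 j hUu hUP hUx hx hs hcr hE hCP hSP habs hθ X₀ hvs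
  -- the class with room at `2ε` and the bordered invariance
  obtain ⟨hs2, -⟩ := levelSmall_of_class_radius (d := 4) hL (by positivity : (0 : ℝ) ≤ 2 * ε) hεD2 hεT2 j
  have hxx' : ε * (((L : ℝ) ^ 2)⁻¹) ^ (j + 1) < 2 * ε * (((L : ℝ) ^ 2)⁻¹) ^ (j + 1) := by
    have hL0 : (0 : ℝ) < L := by exact_mod_cast (show 0 < L by omega)
    have : 0 < (((L : ℝ) ^ 2)⁻¹) ^ (j + 1) := by positivity
    nlinarith
  have hcrit : ∀ Z : ↥(skewSub 4 n (L * tower L N j)),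
      ((stepWt 4 L)⁻¹) ^ (j + 1) * fderiv ℝ (fun Φ : ↥(skewSub 4 n (L * tower L N j)) =>
          fineAction (chart (ContinuousLinearMap.id ℝ (Matrix n n ℂ)) (L * tower L N j) Us (Φ : TDir 4 n (L * tower L N j))) (perWin 4 (N * L ^ (j + 1)))) 0 Z
        = (fderiv ℝ (fun y : ↥(skewSub 4 n N) => minAct 4 (sfClass 4 L N ε) L N (j + 1) (chart (ContinuousLinearMap.id ℝ (Matrix n n ℂ)) N V₀ (y : TDir 4 n N))) 0)
          (fderiv ℝ (fun Φ : ↥(skewSub 4 n (L * tower L N j)) =>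
            levelQ L N j Us (chart (ContinuousLinearMap.id ℝ (Matrix n n ℂ)) (L * tower L N j) Us (Φ : TDir 4 n (L * tower L N j)))) 0 Z) := by
    intro Z
    rw [fderiv_levelQ_chart_subtype_apply (d := 4) hL1 j hUu hUP'' hx hs hUx Z]
    exact hmult Z
  obtain ⟨-, hBinv⟩ := borderedForm_add_gaugeDir (d := 4) hL1 j hUu hUP' hx hxx' hs2 hUx hmus hmuP hmu0 (perWin 4 (N * L ^ (j + 1)))
    (((stepWt 4 L)⁻¹) ^ (j + 1))
    (fderiv ℝ (fun y : ↥(skewSub 4 n N) => minAct 4 (sfClass 4 L N ε) L N (j + 1) (chart (ContinuousLinearMap.id ℝ (Matrix n n ℂ)) N V₀ (y : TDir 4 n N))) 0) hcrit X₀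
  set Xs : ↥(skewSub 4 n (L * tower L N j)) := X₀ + skewPR (d := 4) (n := n) (L * tower L N j) (resDir (L * tower L N j) (gaugeDir Us mu)) with hXs
  refine ⟨Xs, by rw [hq, hQ₀], ?_, ?_, ?_⟩
  · -- the value on the slice representative
    have eW : perWin 4 (tower L N (j + 1)) = perWin 4 (N * L ^ (j + 1)) := by rw [tower_eq_mul_pow L N (j + 1)]
    rw [eW, ← second_variation Us (perWin 4 (N * L ^ (j + 1))) Xs, hBinv, second_variation Us (perWin 4 (N * L ^ (j + 1))) X₀]
    exact hm
  · rw [hQ₀, hUsavg] at hfloor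
    exact hfloor
  · rw [hQ₀] at hmass
    exact hmass

end

end Summit.QuantumFields.BalabanUV.T4Continuum.NE7BorderedHessianOnSlice
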